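import Summits.ResolutionOfSingularities.ResolutionOfSingularities.Theorems.MarkedTransferCampaignW24ReducedRunRenorm
import Summits.ResolutionOfSingularities.ResolutionOfSingularities.Theorems.MarkedTransferCampaignW24ReducedRunC136
import HarnessLib

/-!
# SYMMETRIES OF THE UNIVERSAL REDUCED CASE-(I) RUN AND AN IMMORTALITY CRITERION — a renormalised state that recurs up to
# `g ↦ c·g(λt)` certifies an infinite (never-dying) universal run
# (HIRONAKA-L, kernel support in the OURS reduced model of slot W2.4 / RD-2′ (`CampaignW24.ReducedRun`); res-type-059 g14;
# companion of `MarkedTransferCampaignW24ReducedRunRenorm.lean`)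

**HONEST FRAMING.** OURS throughout: kernel theorems about the one-variable reduced model (`univStep` / `univRun` of
`MarkedTransferCampaignW24ReducedRunUniversal.lean`, res-D-pv-035 AS res-L1-k24). Nothing below is a statement of
[Hironaka2017] (lit key `paper:url-3343fd9e678b`), nothing asserts that any statement of it holds, nothing is a claim about
resolution of singularities in characteristic `p`; the manuscript stays «under review» (D-0012/D-0089). AI work, weaker than
expert review. Use: the exact census kit j277463 (M48 follow-up) finds, e.g. at `p = 7`, carriers whose renormalised bottom class
recurs up to these symmetries (`1 + 4u + 6u²` over `𝔽₇`, period 7 states) — by (I) such universal runs never die, while they hit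
every boundary digit `7^a − 1`; the typed residual «every polynomial universal run dies» is therefore a `p`-dependent statement.

## What is proved (`K` a field of characteristic `p`, `q = p^a`)

* **(S) SYMMETRIES** `univStep_C_mul`, `univStep_rescale`, `univRun_C_mul_rescale`: `univRun (c · g(λt)) i = c · (univRun g i)(λt)`
  for `c, λ ≠ 0` (with `order_C_mul'`, `order_rescale`, `D_C_mul`, `D_rescale`) — the digit sequence is invariant.
* **(I) IMMORTALITY CRITERION** `univRun_ne_zero_of_cycle`: if the run from `S` reaches, at a state `i₁ ≥ 1`, a series `G₁` with
  `ord G₁ = q·j₀ + (q−1)` whose contracted bottom class is `c · S(λu)` (`c, λ ≠ 0`), then `univRun S n ≠ 0` for every `n` — the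
  universal run from `S` NEVER dies; `order_univRun_of_cycle`: its digits after `i₁` are the digits from the start read one scale
  up (`κ ↦ q·κ + (q−1)`), for ever. A finite, checkable certificate for an infinite run.
* `order_univRun_lt_succ` / `order_univRun_lt_of_lt`: digits rise strictly along a live run (any `p`; the in-box hypothesis of
  `canonRun_succ_eq_zero_of_univDigit` for all earlier states follows).
Hypotheses: each theorem's own binders; no FACT-LIST fact, no DEFECT binder; no new definitions. Standard axioms. (`univRun_add` is
res-D-pv-035's, `…ReducedRunC136.lean`; at `p = 2`, `a = 1` the death equivalence of (R) is res-D-pv-020's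
`univRun_eq_zero_iff_oddPart`, `…ReducedRunOddReduction.lean`, in another packaging.)
-/

noncomputable section

set_option linter.dupNamespace false -- mandated namespace of this single-conjunct summit

namespace Summit.ResolutionOfSingularities.ResolutionOfSingularities.Theorems

namespace CampaignW24

namespace ReducedRun

open PowerSeries

universe u

/-! ## (S) Symmetries of the universal run: scalars and dilations `t ↦ λt` -/

section Symmetry

variable {K : Type u} [Field K]

/-- `ord (C c · g) = ord g` for `c ≠ 0`. [folklore] -/
theorem order_C_mul' {c : K} (hc : c ≠ 0) (g : K⟦X⟧) : order (C c * g) = order g := by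
  have h0 : order (C c : K⟦X⟧) = 0 := by
    rw [← Nat.cast_zero, order_eq_nat]
    exact ⟨by rwa [coeff_zero_C], fun i hi => absurd hi (Nat.not_lt_zero i)⟩
  rw [order_mul, h0, zero_add]

/-- `ord (g(λt)) = ord g` for `λ ≠ 0`. [folklore] -/
theorem order_rescale {l : K} (hl : l ≠ 0) (g : K⟦X⟧) : order (rescale l g) = order g := by
  by_cases hg : g = 0
  · rw [hg, map_zero]
  obtain ⟨k, hk⟩ : ∃ k : ℕ, order g = k :=
    ENat.ne_top_iff_exists.mp (fun h => hg (order_eq_top.mp h)) |>.imp fun k hk => hk.symm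
  rw [hk, order_eq_nat, coeff_rescale]
  refine ⟨mul_ne_zero (pow_ne_zero k hl) (order_eq_nat.mp hk).1, fun i hi => ?_⟩
  rw [coeff_rescale, (order_eq_nat.mp hk).2 i hi, mul_zero]

/-- `D^{(k)}` is `K`-linear: `D^{(k)}(C c · f) = C c · D^{(k)} f`. [folklore] -/
theorem D_C_mul (k : ℕ) (c : K) (f : K⟦X⟧) : D k (C c * f) = C c * D k f := by
  rw [← smul_eq_C_mul, ← smul_eq_C_mul, LinearMap.map_smul]

/-- `D^{(k)}(f(λt)) = λ^k · (D^{(k)} f)(λt)`. [folklore] -/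
theorem D_rescale (k : ℕ) (l : K) (f : K⟦X⟧) : D k (rescale l f) = C (l ^ k) * rescale l (D k f) := by
  ext n
  rw [coeff_D, coeff_rescale, coeff_C_mul, coeff_rescale, coeff_D, pow_add]
  ring

/-- `(C b · t^k)(λt) = C (λ^k b) · t^k`. [folklore] -/
theorem rescale_C_mul_X_pow (l b : K) (k : ℕ) : rescale l (C b * X ^ k) = C (l ^ k * b) * X ^ k := by
  ext n
  rw [coeff_rescale, coeff_C_mul, coeff_C_mul, coeff_X_pow]
  split_ifs with h
  · rw [h, mul_one, mul_one]
  · rw [mul_zero, mul_zero, mul_zero]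

/-- `(C b)(λt) = C b`. [folklore] -/
theorem rescale_C' (l b : K) : rescale l (C b : K⟦X⟧) = C b := by
  have h := rescale_C_mul_X_pow l b 0
  rwa [pow_zero, mul_one, pow_zero, one_mul, mul_one] at h

/-- **SCALAR SYMMETRY.** `univStep (C c · g) = C c · univStep g` (`c ≠ 0`). [folklore] -/
theorem univStep_C_mul {c : K} (hc : c ≠ 0) (g : K⟦X⟧) : univStep (C c * g) = C c * univStep g := by
  by_cases hg : g = 0
  · rw [hg, mul_zero, univStep_zero', mul_zero]
  obtain ⟨k, hk⟩ : ∃ k : ℕ, order g = k :=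
    ENat.ne_top_iff_exists.mp (fun h => hg (order_eq_top.mp h)) |>.imp fun k hk => hk.symm
  have hck : order (C c * g) = k := by rw [order_C_mul' hc, hk]
  rw [univStep, univStep, hck, hk, ENat.toNat_coe, univStepI, univStepI, coeff_C_mul, mul_inv, map_mul,
    show C c * g - C (c * coeff k g) * X ^ k = C c * (g - C (coeff k g) * X ^ k) by rw [map_mul]; ring, D_C_mul]
  have hc' : C c⁻¹ * C c = (1 : K⟦X⟧) := by rw [← map_mul, inv_mul_cancel₀ hc, map_one]
  linear_combination (-(C c * C (coeff k g)⁻¹ * g * D k (g - C (coeff k g) * X ^ k))) * hc'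

/-- **DILATION SYMMETRY.** `univStep (g(λt)) = (univStep g)(λt)` (`λ ≠ 0`). [folklore] -/
theorem univStep_rescale {l : K} (hl : l ≠ 0) (g : K⟦X⟧) : univStep (rescale l g) = rescale l (univStep g) := by
  by_cases hg : g = 0
  · rw [hg, map_zero, univStep_zero', map_zero]
  obtain ⟨k, hk⟩ : ∃ k : ℕ, order g = k :=
    ENat.ne_top_iff_exists.mp (fun h => hg (order_eq_top.mp h)) |>.imp fun k hk => hk.symm
  have hlk : order (rescale l g) = k := by rw [order_rescale hl, hk]
  have hlk0 : (l ^ k) ≠ 0 := pow_ne_zero k hl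
  rw [univStep, univStep, hlk, hk, ENat.toNat_coe, univStepI, univStepI, coeff_rescale, mul_inv, map_mul,
    ← rescale_C_mul_X_pow, ← map_sub, D_rescale, map_neg, map_mul (rescale l), map_mul (rescale l), rescale_C']
  have hl' : C (l ^ k)⁻¹ * C (l ^ k) = (1 : K⟦X⟧) := by rw [← map_mul, inv_mul_cancel₀ hlk0, map_one]
  linear_combination (-(C (coeff k g)⁻¹ * rescale l g * rescale l (D k (g - C (coeff k g) * X ^ k)))) * hl'

/-- **SYMMETRY OF THE RUN.** `univRun (C c · g(λt)) i = C c · (univRun g i)(λt)` (`c, λ ≠ 0`): the digit sequence of the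
universal run is invariant under `g ↦ c · g(λt)`. [folklore] -/
theorem univRun_C_mul_rescale {c l : K} (hc : c ≠ 0) (hl : l ≠ 0) (g : K⟦X⟧) :
    ∀ i : ℕ, univRun (C c * rescale l g) i = C c * rescale l (univRun g i)
  | 0 => rfl
  | i + 1 => by
    show univStep (univRun (C c * rescale l g) i) = C c * rescale l (univStep (univRun g i))
    rw [univRun_C_mul_rescale hc hl g i, univStep_C_mul hc, univStep_rescale hl]

/-- `C c · f(λt) = 0 ↔ f = 0` (`c, λ ≠ 0`). [folklore] -/
theorem C_mul_rescale_eq_zero_iff {c l : K} (hc : c ≠ 0) (hl : l ≠ 0) (f : K⟦X⟧) :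
    C c * rescale l f = 0 ↔ f = 0 := by
  rw [← order_eq_top, order_C_mul' hc, order_rescale hl, order_eq_top]

end Symmetry

/-! ## Digits rise strictly along a live run (any `p`) -/

section LiveRun

variable {K : Type u} [Field K]

/-- **Orders rise strictly along a live run** (any characteristic `p`): `ord (univRun g i) < ord (univRun g (i+1))` while both
states are non-zero — the tree's `exists_order_univStepI` (res-L1-type-o6's `order_lt_order_univRun_succ` is the `p = 2` copy).
[folklore] -/
theorem order_univRun_lt_succ (p : ℕ) [Fact p.Prime] [CharP K p] (g : K⟦X⟧) (i : ℕ) (hi : univRun g i ≠ 0)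
    (hi' : univRun g (i + 1) ≠ 0) :
    order (univRun g i) < order (univRun g (i + 1)) := by
  obtain ⟨κ, hκ⟩ := exists_order_eq_nat hi
  have hgκ : coeff κ (univRun g i) ≠ 0 := (order_eq_nat.mp hκ).1
  have hstep : univRun g (i + 1) = univStepI (coeff κ (univRun g i))⁻¹ κ (univRun g i) := by
    show univStep (univRun g i) = _
    rw [univStep, hκ, ENat.toNat_coe]
  rw [hstep] at hi' ⊢
  obtain ⟨κ', hκ', hlt, -⟩ := exists_order_univStepI p (inv_ne_zero hgκ) hκ hi'
  rw [hκ, hκ']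
  exact_mod_cast hlt

/-- **Digits rise strictly along a live run**: `ord (univRun g j) < ord (univRun g i)` for `j < i` whenever state `i` is
non-zero. [folklore] -/
theorem order_univRun_lt_of_lt (p : ℕ) [Fact p.Prime] [CharP K p] (g : K⟦X⟧) {j : ℕ} : ∀ {i : ℕ}, j < i → univRun g i ≠ 0 →
    order (univRun g j) < order (univRun g i)
  | 0, hji, _ => absurd hji (Nat.not_lt_zero j)
  | i + 1, hji, hi => by
    have hprev : univRun g i ≠ 0 := fun h0 => hi (by
      show univStep (univRun g i) = 0
      rw [h0, univStep_zero'])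
    rcases Nat.lt_succ_iff_lt_or_eq.mp hji with h | rfl
    · exact (order_univRun_lt_of_lt p g h hprev).trans (order_univRun_lt_succ p g i hprev hi)
    · exact order_univRun_lt_succ p g j hprev hi

end LiveRun

/-! ## (I) An immortality criterion: a renormalised state that recurs up to symmetry -/

section Immortal

variable {K : Type u} [Field K]

variable (p : ℕ) [hp : Fact p.Prime] [CharP K p]

/-- **IMMORTALITY CRITERION (I).** Suppose the universal run from `S` reaches at a state `i₁ ≥ 1` a series `G₁` whose bottom
digit is `≡ −1 (mod q)` (`q = p^a`, `ord G₁ = q·j₀ + (q−1)`) and whose contracted bottom class is `c · S(λu)` with `c, λ ≠ 0`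
(`coeff r (C c · S(λ·)) = coeff (q·r + (q−1)) G₁`). Then the universal run from `S` NEVER DIES: `univRun S n ≠ 0` for all `n`.
(By (R) the run after `G₁` is the run of `c·S(λu)`, by (S) that is the run of `S` again, one scale up; strong induction.)
A finite certificate for an infinite run — the kernel form of the «IMMORTAL» verdicts of the exact census kit j277234.
OURS (reduced model). [folklore] -/
theorem univRun_ne_zero_of_cycle {a j₀ i₁ : ℕ} {S G₁ : K⟦X⟧} {c l : K} (hc : c ≠ 0) (hl : l ≠ 0) (hi₁ : 0 < i₁)
    (hrun : univRun S i₁ = G₁) (hG₁ : order G₁ = (p ^ a * j₀ + (p ^ a - 1) : ℕ))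
    (hcyc : ∀ r, coeff r (C c * rescale l S) = coeff (p ^ a * r + (p ^ a - 1)) G₁) :
    ∀ n : ℕ, univRun S n ≠ 0 := by
  have hG₁0 : G₁ ≠ 0 := fun h => by
    have := (order_eq_nat.mp hG₁).1
    rw [h, map_zero] at this
    exact this rfl
  intro n
  induction n using Nat.strong_induction_on with
  | _ n ih =>
    intro hn
    by_cases hle : n ≤ i₁
    · exact hG₁0 (hrun ▸ univRun_eq_zero_of_le S hn hle)
    · obtain ⟨m, rfl⟩ := Nat.exists_eq_add_of_lt (lt_of_not_ge hle)
      have hm : univRun G₁ (m + 1) = 0 := by rw [← hrun, ← univRun_add, ← add_assoc, hn]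
      rw [univRun_eq_zero_iff p hG₁ hcyc, univRun_C_mul_rescale hc hl, C_mul_rescale_eq_zero_iff hc hl] at hm
      exact ih (m + 1) (by omega) hm

/-- **DIGITS OF AN IMMORTAL RUN (self-similarity).** In the situation of (I): if the run from `S` has bottom digit `κ` at
state `m`, then it has bottom digit `q·κ + (q−1)` at state `i₁ + m`. So the digit sequence after `i₁` is the digit sequence
from the start, read one scale up (`κ ↦ q·κ + (q−1)`), for ever. [folklore] -/
theorem order_univRun_of_cycle {a j₀ i₁ : ℕ} {S G₁ : K⟦X⟧} {c l : K} (hc : c ≠ 0) (hl : l ≠ 0)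
    (hrun : univRun S i₁ = G₁) (hG₁ : order G₁ = (p ^ a * j₀ + (p ^ a - 1) : ℕ))
    (hcyc : ∀ r, coeff r (C c * rescale l S) = coeff (p ^ a * r + (p ^ a - 1)) G₁) (m : ℕ) {κ : ℕ}
    (hκ : order (univRun S m) = κ) : order (univRun S (i₁ + m)) = (p ^ a * κ + (p ^ a - 1) : ℕ) := by
  rw [univRun_add, hrun]
  refine order_univRun_renorm p hG₁ hcyc m ?_
  rw [univRun_C_mul_rescale hc hl, order_C_mul' hc, order_rescale hl, hκ]

end Immortal

end ReducedRun

end CampaignW24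

end Summit.ResolutionOfSingularities.ResolutionOfSingularities.Theorems

end
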